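import Summits.HodgeConjecture.HodgeConjecture.Theorems.F0P3InnerFormClassificationV6   -- ★ V6-D (p03 (g6)): `KitFamily`, `KitFamily.IsPinned`, `KitFamily.Laws`, `shapeGuarded_of_T5`
import Summits.HodgeConjecture.HodgeConjecture.Theorems.F0P3KitOfRecordClosed            -- (K1′∕K7 ED. 2): `isPinned_kitOfRecord₀`, `laws_kitOfRecord_of₂` (+ ★ K0 `kitOfRecord`, ★ «RC» `ramCls₀`)
import Summits.HodgeConjecture.HodgeConjecture.Theorems.F0P3GuardedLettersOfGuardedShape  -- ★ p820383 (B0 ED. 2): `letters_of_guardedEngine` (v4∕v5∕v6 head ⇒ `StubE1coh`-body ∧ E2′)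
import HarnessLib

/-!
# Crux `H413` — T5 ED. 4, K9 interface: **the KIT FAMILY OF RECORD `kitFamilyOfRecord 𝔇 : KitFamily`** (V6-D) — `kitOfRecord` at every letters' frame, the non-universal data
# bundled as ONE family `𝔇` of per-frame records `FrameData` (RULING (V37)(2), REF1 (k0-3)); family-level `IsPinned` (zero residual hypotheses but Haar) and `Laws`;
# and the composition with the ★ head and ★ B0 ED. 2: `letters_of_kitFamilyOfRecord : 𝔎₀.Laws → <StubE1coh body> ∧ E2′`

PLAN.F0P3g5 §5 K9 interface (p04 (g7)).  `KitFamily` (★ V6-D :259) binds `(L) [..] (ι H T hT), hdef → h2 → ∀ (μ) [..] (μω hμu), hμω →`; there is NO measurable structure on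
`G′(𝔸)` among the binders, so the family fixes `borel` on `(Gp L H).Adelic` (T1's pins read `[MeasurableSpace] [BorelSpace]` — instantiate with `borel` at K9 likewise).
* §1 `structure FrameData L H ι T hT μ` — the per-frame external data of `kitOfRecord`: T1's sockets `𝔰`, the G∕H side `gh`, the ξ side `ξd`, the sign `c`, `jInf`, `dsInf`, `archTr`,
  the Haar measure `ν` on `G′(𝔸)` (for `borel`) with `IsFiniteMeasureOnCompacts`, the finite Haar family `μv` with `IsHaarMeasure`.
* §2 **`kitFamilyOfRecord (𝔇 : ∀ frame, FrameData …) : KitFamily := fun frame => kitOfRecord … (𝔇 frame).𝔰 … F0P3RamClsOfRecord.ramCls₀`** + `kitFamilyOfRecord_apply` (`rfl`).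
* §3 **`isPinned_kitFamilyOfRecord 𝔇 : (kitFamilyOfRecord 𝔇).IsPinned`** — NO HYPOTHESIS (★ `isPinned_kitOfRecord₀` at every frame; `hdef`, `h2` are the family's own binders,
  the Haar facts are fields of `𝔇`).
* §4 `laws_kitFamilyOfRecord_of (H : ∀ frame, (kitFamilyOfRecord 𝔇 frame).Laws μω hμu) : (kitFamilyOfRecord 𝔇).Laws` (binder plumbing) and
  **`letters_of_kitFamilyOfRecord 𝔇 (hlaws : (kitFamilyOfRecord 𝔇).Laws) : <StubE1coh body> ∧ Rogawski1990.hodgeTypeRigid`** := ★ `letters_of_guardedEngine (shapeGuarded_of_T5 _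
  (isPinned_kitFamilyOfRecord 𝔇) hlaws)` — the two letters the HJ3a line consumes, from the LAWS OF `𝔎₀` ALONE (pins discharged).
One structure + one def WITH BODIES + theorems; no `sorry`, no named fact, no instance declaration, no notation (`letI := borel _` inside terms only).
`--supports stmt-HodgeConjecture-24833 --as helper`.  HONEST LABEL: HC_CM is proved only modulo the printed citations until rung 0 closes.
-/

set_option autoImplicit false
set_option linter.dupNamespace false

-- Mathlib idiom (★ (𝔤,K) files): commutator bracket on `Module.End ℂ M`, to MENTION the token binders of `StubE1coh`'s body.
attribute [local instance 100] LieRing.ofAssociativeRing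

noncomputable section

open NumberField IsDedekindDomain MeasureTheory
open Literature.NumberTheory.Rogawski1990 Literature.NumberTheory.GaloisRepresentations
open Literature.NumberTheory.Automorphic Literature.NumberTheory.Automorphic.UnitaryGroup
open Literature.NumberTheory.Automorphic.UnitaryGroup.CotangentForms
open Literature.RepresentationTheory.BorelWallach2000 Literature.RepresentationTheory.KonnoKonno2007
open scoped Matrix ComplexOrder

namespace Summit.HodgeConjecture.HodgeConjecture.Cruxes.H413.F0P3KitOfRecord

open Summit.HodgeConjecture.HodgeConjecture.Cruxes.H413.F0P3InnerFormClassificationV6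
open Summit.HodgeConjecture.HodgeConjecture.Cruxes.H413.F0P3RamClsOfRecord (ramCls₀)
open Summit.HodgeConjecture.HodgeConjecture.Cruxes.H413.F0P3GuardedLettersOfGuardedShape (letters_of_guardedEngine)

/-! ## §1 Per-frame external data -/

/-- **`FrameData L H ι T hT μ`** — the external data of `kitOfRecord` at ONE frame (everything that is not a ★ token of record): T1's sockets, the G∕H-side `S`-carriers, the
ξ∕packet data, the global sign `c` (R-21), the posited archimedean classes `jInf dsInf` (R-22′), the archimedean character `archTr` (D8-1), the Haar measure `ν` on `G′(𝔸)` for the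
Borel structure (finite on compacts) and the finite Haar family `μv`. [Rogawski1990 §14.5–14.6] -/
structure FrameData (L : Type) [Field L] [NumberField L] [IsCMField L] (H : Matrix (Fin 3) (Fin 3) L) (ι : L →+* ℂ) (T : GL (Fin 3) ℂ)
    (hT : (T : Matrix (Fin 3) (Fin 3) ℂ)ᴴ * H.map ι * (T : Matrix (Fin 3) (Fin 3) ℂ) = Literature.Geometry.ComplexHyperbolic.BallModel.J)
    (μ : Measure (Gp L H).automorphicQuotient) [(Gp L H).IsAutomorphicMeasure μ] : Type 2 where
  /-- T1's sockets (14.6.1) -/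
  𝔰 : Sockets L H μ
  /-- the G∕H-side `S`-carriers -/
  gh : GHSide L H ι T hT 𝔰.PacketG 𝔰.PacketH
  /-- the ξ∕packet data -/
  ξd : XiSide L H 𝔰.PacketG 𝔰.PacketH
  /-- the ONE global transfer-factor sign `c` (R-21) -/
  c : ℚ
  /-- the posited archimedean classes `J^±_φ` off the cohomological locus (R-22′) -/
  jInf : ℤ → ℤ → ℤ → Cinf
  /-- the posited archimedean classes `D^∓_φ ∕ π²_φ` (R-22′) -/
  dsInf : ℤ → ℤ → ℤ → Cinf
  /-- the archimedean distribution character (D8-1) -/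
  archTr : Cinf → (UnitaryGroup.arch (↥(maximalRealSubfield L)) L (IsCMField.complexConj L) 3 H → ℂ) → ℂ
  /-- the Haar measure on `G′(𝔸)` (Borel structure) -/
  ν : @Measure (Gp L H).Adelic (borel _)
  /-- `ν` is finite on compact sets -/
  isFiniteMeasureOnCompacts_ν : letI : MeasurableSpace (Gp L H).Adelic := borel _; IsFiniteMeasureOnCompacts ν
  /-- the Haar family at the finite places (Borel structures) -/
  μv : ∀ v : Places L, @Measure ((cmDatum L 3 H).Local v) (borel _)
  /-- each `μv v` is a Haar measure (pin (iii)) -/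
  isHaarMeasure_μv : ∀ v : Places L, letI : MeasurableSpace ((cmDatum L 3 H).Local v) := borel _; (μv v).IsHaarMeasure

/-! ## §2 The kit family of record -/

/-- **`kitFamilyOfRecord 𝔇 : KitFamily`** — at every letters' frame the kit of record `kitOfRecord` (★ K0) with the exact ramification set ★ `F0P3RamClsOfRecord.ramCls₀`, the family's
own `μω`, and the external data `𝔇 frame`; the Borel structure on `G′(𝔸)` fixed inside. [cite: Rogawski1990, §14.6 Thm. 14.6.4 pp. 236–244] -/
def kitFamilyOfRecord
    (𝔇 : ∀ (L : Type) [Field L] [NumberField L] [IsCMField L] (ι : L →+* ℂ) (H : Matrix (Fin 3) (Fin 3) L) (T : GL (Fin 3) ℂ)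
      (hT : (T : Matrix (Fin 3) (Fin 3) ℂ)ᴴ * H.map ι * (T : Matrix (Fin 3) (Fin 3) ℂ) = Literature.Geometry.ComplexHyperbolic.BallModel.J),
      (∀ τ' : L →+* ℂ, InfinitePlace.mk τ' ≠ InfinitePlace.mk ι → (H.map τ').PosDef) →
      2 ≤ Module.finrank ℚ ↥(maximalRealSubfield L) →
      ∀ (μ : Measure (Gp L H).automorphicQuotient) [(Gp L H).IsAutomorphicMeasure μ] (μω : HeckeCharacter L) (_hμu : μω.IsUnitary),
      (∀ x : Literature.NumberTheory.GaloisRepresentations.ideleGroup ↥(maximalRealSubfield L),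
        μω (AdeleRing.ideleBaseChange (↥(maximalRealSubfield L)) L x) = quadraticHeckeCharCM L x) → FrameData L H ι T hT μ) :
    KitFamily :=
  fun L _ _ _ ι H T hT hdef h2 μ _ μω hμu hμω =>
    letI : MeasurableSpace (Gp L H).Adelic := borel _
    haveI : BorelSpace (Gp L H).Adelic := ⟨rfl⟩
    haveI := (𝔇 L ι H T hT hdef h2 μ μω hμu hμω).isFiniteMeasureOnCompacts_ν
    kitOfRecord L H ι T hT μ (𝔇 L ι H T hT hdef h2 μ μω hμu hμω).𝔰 (𝔇 L ι H T hT hdef h2 μ μω hμu hμω).gh (𝔇 L ι H T hT hdef h2 μ μω hμu hμω).ξd μω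
      (𝔇 L ι H T hT hdef h2 μ μω hμu hμω).c (𝔇 L ι H T hT hdef h2 μ μω hμu hμω).jInf (𝔇 L ι H T hT hdef h2 μ μω hμu hμω).dsInf
      (𝔇 L ι H T hT hdef h2 μ μω hμu hμω).archTr (𝔇 L ι H T hT hdef h2 μ μω hμu hμω).ν (𝔇 L ι H T hT hdef h2 μ μω hμu hμω).μv ramCls₀

section Family

variable (𝔇 : ∀ (L : Type) [Field L] [NumberField L] [IsCMField L] (ι : L →+* ℂ) (H : Matrix (Fin 3) (Fin 3) L) (T : GL (Fin 3) ℂ)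
      (hT : (T : Matrix (Fin 3) (Fin 3) ℂ)ᴴ * H.map ι * (T : Matrix (Fin 3) (Fin 3) ℂ) = Literature.Geometry.ComplexHyperbolic.BallModel.J),
      (∀ τ' : L →+* ℂ, InfinitePlace.mk τ' ≠ InfinitePlace.mk ι → (H.map τ').PosDef) →
      2 ≤ Module.finrank ℚ ↥(maximalRealSubfield L) →
      ∀ (μ : Measure (Gp L H).automorphicQuotient) [(Gp L H).IsAutomorphicMeasure μ] (μω : HeckeCharacter L) (_hμu : μω.IsUnitary),
      (∀ x : Literature.NumberTheory.GaloisRepresentations.ideleGroup ↥(maximalRealSubfield L),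
        μω (AdeleRing.ideleBaseChange (↥(maximalRealSubfield L)) L x) = quadraticHeckeCharCM L x) → FrameData L H ι T hT μ)

/-- Unfolding `kitFamilyOfRecord` at a frame (`rfl`). -/
theorem kitFamilyOfRecord_apply (L : Type) [Field L] [NumberField L] [IsCMField L] (ι : L →+* ℂ) (H : Matrix (Fin 3) (Fin 3) L) (T : GL (Fin 3) ℂ)
    (hT : (T : Matrix (Fin 3) (Fin 3) ℂ)ᴴ * H.map ι * (T : Matrix (Fin 3) (Fin 3) ℂ) = Literature.Geometry.ComplexHyperbolic.BallModel.J)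
    (hdef : ∀ τ' : L →+* ℂ, InfinitePlace.mk τ' ≠ InfinitePlace.mk ι → (H.map τ').PosDef) (h2 : 2 ≤ Module.finrank ℚ ↥(maximalRealSubfield L))
    (μ : Measure (Gp L H).automorphicQuotient) [(Gp L H).IsAutomorphicMeasure μ] (μω : HeckeCharacter L) (hμu : μω.IsUnitary)
    (hμω : ∀ x : Literature.NumberTheory.GaloisRepresentations.ideleGroup ↥(maximalRealSubfield L),
      μω (AdeleRing.ideleBaseChange (↥(maximalRealSubfield L)) L x) = quadraticHeckeCharCM L x) :
    kitFamilyOfRecord 𝔇 L ι H T hT hdef h2 μ μω hμu hμω =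
      (letI : MeasurableSpace (Gp L H).Adelic := borel _
       haveI : BorelSpace (Gp L H).Adelic := ⟨rfl⟩
       haveI := (𝔇 L ι H T hT hdef h2 μ μω hμu hμω).isFiniteMeasureOnCompacts_ν
       kitOfRecord L H ι T hT μ (𝔇 L ι H T hT hdef h2 μ μω hμu hμω).𝔰 (𝔇 L ι H T hT hdef h2 μ μω hμu hμω).gh (𝔇 L ι H T hT hdef h2 μ μω hμu hμω).ξd μω
         (𝔇 L ι H T hT hdef h2 μ μω hμu hμω).c (𝔇 L ι H T hT hdef h2 μ μω hμu hμω).jInf (𝔇 L ι H T hT hdef h2 μ μω hμu hμω).dsInf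
         (𝔇 L ι H T hT hdef h2 μ μω hμu hμω).archTr (𝔇 L ι H T hT hdef h2 μ μω hμu hμω).ν (𝔇 L ι H T hT hdef h2 μ μω hμu hμω).μv ramCls₀) := rfl

/-! ## §3 The family is PINNED — no hypothesis -/

/-- **`isPinned_kitFamilyOfRecord 𝔇 : (kitFamilyOfRecord 𝔇).IsPinned`** — NO HYPOTHESIS: at every letters' frame the kit of record is pinned (★ `isPinned_kitOfRecord₀`; the compact CM
frame `hdef h2` is the family's own binder pair, the Haar facts are fields of `𝔇`). [cite: Rogawski1990, §14.5 p. 237; §13.7 p. 206] [cite: FlathCorvallis1979, Thm. 3] -/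
theorem isPinned_kitFamilyOfRecord : (kitFamilyOfRecord 𝔇).IsPinned := by
  intro L _ _ _ ι H T hT hdef h2 μ _ μω hμu hμω
  letI : MeasurableSpace (Gp L H).Adelic := borel _
  haveI : BorelSpace (Gp L H).Adelic := ⟨rfl⟩
  haveI := (𝔇 L ι H T hT hdef h2 μ μω hμu hμω).isFiniteMeasureOnCompacts_ν
  exact isPinned_kitOfRecord₀ L H ι T hT μ (𝔇 L ι H T hT hdef h2 μ μω hμu hμω).𝔰 (𝔇 L ι H T hT hdef h2 μ μω hμu hμω).gh (𝔇 L ι H T hT hdef h2 μ μω hμu hμω).ξd μω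
    (𝔇 L ι H T hT hdef h2 μ μω hμu hμω).c (𝔇 L ι H T hT hdef h2 μ μω hμu hμω).jInf (𝔇 L ι H T hT hdef h2 μ μω hμu hμω).dsInf (𝔇 L ι H T hT hdef h2 μ μω hμu hμω).archTr
    (𝔇 L ι H T hT hdef h2 μ μω hμu hμω).ν (𝔇 L ι H T hT hdef h2 μ μω hμu hμω).μv hdef h2 (𝔇 L ι H T hT hdef h2 μ μω hμu hμω).isHaarMeasure_μv

/-! ## §4 The laws at the family, and the LETTERS OF THE HJ3a LINE from the laws alone -/

/-- **Family-level `Laws` from frame-wise `Laws`** (binder plumbing: `KitFamily.Laws` IS the frame-wise statement). [cite: Rogawski1990, §14.6 Thm. 14.6.4] -/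
theorem laws_kitFamilyOfRecord_of
    (hL : ∀ (L : Type) [Field L] [NumberField L] [IsCMField L] (ι : L →+* ℂ) (H : Matrix (Fin 3) (Fin 3) L) (T : GL (Fin 3) ℂ)
      (hT : (T : Matrix (Fin 3) (Fin 3) ℂ)ᴴ * H.map ι * (T : Matrix (Fin 3) (Fin 3) ℂ) = Literature.Geometry.ComplexHyperbolic.BallModel.J)
      (hdef : ∀ τ' : L →+* ℂ, InfinitePlace.mk τ' ≠ InfinitePlace.mk ι → (H.map τ').PosDef) (h2 : 2 ≤ Module.finrank ℚ ↥(maximalRealSubfield L))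
      (μ : Measure (Gp L H).automorphicQuotient) [(Gp L H).IsAutomorphicMeasure μ] (μω : HeckeCharacter L) (hμu : μω.IsUnitary)
      (hμω : ∀ x : Literature.NumberTheory.GaloisRepresentations.ideleGroup ↥(maximalRealSubfield L),
        μω (AdeleRing.ideleBaseChange (↥(maximalRealSubfield L)) L x) = quadraticHeckeCharCM L x),
      (kitFamilyOfRecord 𝔇 L ι H T hT hdef h2 μ μω hμu hμω).Laws μω hμu) :
    (kitFamilyOfRecord 𝔇).Laws :=
  fun L _ _ _ ι H T hT hdef h2 μ _ μω hμu hμω => hL L ι H T hT hdef h2 μ μω hμu hμω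

/-- **THE LETTERS OF THE HJ3a LINE FROM THE LAWS OF `𝔎₀` ALONE**: `StubE1coh`'s body ∧ E2′ `hodgeTypeRigid` — ★ B0 ED. 2 `letters_of_guardedEngine` ∘ ★ V6-D `shapeGuarded_of_T5` at the kit
family of record, its pins discharged by §3.  With ★ `stubE1hFold_holds_coh_cpt`, ★ `stubF1aCM_holds`∕`stubF1bCM_holds`, ★ (D)h, ★ (E)h this is every input of ★
`HJ3aOfLettersCoh.hJ3a_of_five_letters_coh` (K9, planner's Lines ED. 4). [cite: Rogawski1990, §14.6 Thm. 14.6.4; §15.3 ¶1; Prop. 15.2.1 (b)] [cite: BorelWallach2000, VI Thm. 4.11] -/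
theorem letters_of_kitFamilyOfRecord (hlaws : (kitFamilyOfRecord 𝔇).Laws) :
    (∀ (L : Type) [Field L] [NumberField L] [IsCMField L] (ι : L →+* ℂ) (H : Matrix (Fin 3) (Fin 3) L) (T : GL (Fin 3) ℂ)
      (hT : (T : Matrix (Fin 3) (Fin 3) ℂ)ᴴ * H.map ι * (T : Matrix (Fin 3) (Fin 3) ℂ) = Literature.Geometry.ComplexHyperbolic.BallModel.J),
      (∀ τ' : L →+* ℂ, InfinitePlace.mk τ' ≠ InfinitePlace.mk ι → (H.map τ').PosDef) →
      2 ≤ Module.finrank ℚ ↥(maximalRealSubfield L) →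
      ∀ (μ : Measure (adelicGroupData (↥(maximalRealSubfield L)) L (IsCMField.complexConj L) 3 H).automorphicQuotient)
        [(adelicGroupData (↥(maximalRealSubfield L)) L (IsCMField.complexConj L) 3 H).IsAutomorphicMeasure μ]
        (P : DiscreteAutomorphicRep (adelicGroupData (↥(maximalRealSubfield L)) L (IsCMField.complexConj L) 3 H) μ),
        (P.IsHolCotangentAt (cmArchSection L ι H T hT) (cmCompactFactor L ι H T hT) ∨
          P.IsAntiholCotangentAt (cmArchSection L ι H T hT) (cmCompactFactor L ι H T hT)) →
        ((adelicGroupData (↥(maximalRealSubfield L)) L (IsCMField.complexConj L) 3 H).rightRegular μ).multiplicity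
            P.space.toContRep ≤ 1) ∧
    Literature.NumberTheory.Rogawski1990.hodgeTypeRigid :=
  letters_of_guardedEngine (shapeGuarded_of_T5 (kitFamilyOfRecord 𝔇) (isPinned_kitFamilyOfRecord 𝔇) hlaws)

end Family

end Summit.HodgeConjecture.HodgeConjecture.Cruxes.H413.F0P3KitOfRecord

end
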